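import Literature.Probability.RandomPlanarGeometry.HexSAWStripBridgeContactDensityPointwise
import Literature.Probability.RandomPlanarGeometry.HexSAWStripWidthTwoKernel
import Literature.Probability.Process.MatrixRenewalRewardSecondMoment
import Literature.Probability.RandomPlanarGeometry.HexSAWStripBridgeRenewalPointLLN
import HarnessLib

/-!
# The surface contacts of a long critical strip bridge CONCENTRATE at `θ_T · n` whenever the critical irreducible kernel has a finite second
# contact moment — unconditionally at width two: `#top/n → (3 − √2)/4` in probability (module «CONTACT-LLN»)

Topic `Literature/Probability/RandomPlanarGeometry` (continues «CONTACT-DENSITY-POINTWISE» #687 `HexSAWStripBridgeContactDensityPointwise.lean` — the derived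
renewal equation on the parity classes `HV.hat_contact_ren`, `HV.hasSum_hat_contactIrr`, `HV.hat_contactSlices_facts`, ★ `HV.tendsto_contacts_per_step_pointwise`
(`Ĉ_D(k)_{ab}/(n_k D̂(k)_{ab}) → θ_T`); «CONTACT-DENSITY» (`HV.hasDerivAt_LUs/LMs`, `HV.mul_derivSum_eq_contactSum`); «RENEWAL-POINT-LLN» p507811
(`HV.tendsto_succ_div_hatLen_half`); «WIDTH-TWO-KERNEL» #715 (`W2.hlen_of_mem_HBk_two`, `W2.contactMomentMatrix_two_eq`, `W2.lengthMomentMatrix_two_eq`,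
`W2.contact_scalar_two`, `W2.perron_scalars_two`, `W2.Iinf_two_fixed`); and the abstract «MATRIX-RENEWAL-REWARD-VARIANCE»
`Process/MatrixRenewalRewardSecondMoment.lean` (`RenewalKernelPair.tendsto_S2_div_sq_D`: `S₂(m)/((m+1)²D(m)) → θ²` for `S₂ = R₂ + Σ(R₂D + 2R₁S₁ + MS₂)`,
`R₂` summable)).  Lane «pcv-sawmu» (CriticalPhenomena venture), a-p2 g24 — HANDOFF-gen23 item 3 for the CONTACT count.  Sources of the SETTING / TEMPLATE:
H. Duminil-Copin, A. Hammond, CMP 324 (2013) §2.2; N. R. Beaton et al., CMP 326 (2014) §3.2, Corollary 8 (`y_T`: «there exists a unique `y_T > 0` such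
that `ρ_T(y_T) = x_c`», arXiv v5 p. 12); W. Feller I (1968) XIII.3, XIII.6 (mean and variance of the number of renewals); E. Seneta (1973) §6.2.
Nothing of the kind is printed for the strip.

## What is proved (namespace `Literature.Probability.RandomPlanarGeometry.SAW.HV`; hat index `n_k = 2k + χ_a − χ_b`, truncation `2k + 1`;
## `Ĉ_X(k)_{ab} = Σ #top·wD`, `Ĉ²_X(k)_{ab} = Σ #top²·wD` over the bridges (`X = D`) / irreducible bridges (`X = M`) `a → b` with `n_k` steps at `y`)

* §1 `hasDerivAt_contactSum`, `mul_derivContactSum_eq` — `y∂_y Σ #top·wD = Σ #top²·wD` (finite sums of monomials).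
* §2 ★★ `hat_contactSq_ren` — **`Ĉ²_D(k) = Ĉ²_M(k) + Σ_{i+j=k}(Ĉ²_M(i)D̂(j) + 2Ĉ_M(i)Ĉ_D(j) + M̂(i)Ĉ²_D(j))`** for every `y > 0`: `y∂_y` of #687's derived
  renewal equation (the recursion of the SQUARED additive reward — hypothesis `renS₂` of the abstract theorem, verbatim).
* §3 (`T ≥ 2`; `u`, `ℓ` ANY positive fixed vectors of `Iinf T y_T`; `θ_T := ⟨ℓ, C̄_M u⟩/⟨ℓ, M̄_len u⟩` as in #687; ALL THREE CONDITIONAL on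
  `hC2 : ∀ a b, Summable (k ↦ Ĉ²_M(k)_{ab})` at `y_T` — a finite second contact moment of the critical irreducible kernel, OPEN for `T ≥ 3`):
  `hat_contactSqSlices_facts`; ★★★★ `tendsto_contactSq_per_step_sq` — `Ĉ²_D(k)_{ab}/(n_k² D̂(k)_{ab}) → θ_T²`;
  ★★★★ `tendsto_contacts_variance` — `Σ_{bridges a→b, n_k steps}(#top − θ_T n_k)²·wD/(n_k² D̂(k)_{ab}) → 0`;
  ★★★★ `tendsto_contacts_deviation` — for every `ε > 0`, `(Σ_{bridges a→b, n_k steps, |#top/n_k − θ_T| ≥ ε} wD)/D̂(k)_{ab} → 0` (Chebyshev).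
* §4 `T = 2`, UNCONDITIONAL: `widthTwo_contactSqIrr_eq_zero` (`Ĉ²_M(k) = 0` for `k ≥ 2`: the kernel of `S₂` is a polynomial, #715),
  ★ `widthTwo_summable_contactSqIrr` (`hC2` holds at `T = 2`), ★★★★ `widthTwo_contacts_deviation` —
  **`(Σ_{bridges a→b with n_k steps and |#top/n_k − (3 − √2)/4| ≥ ε} x_c^{n_k} y₂^{#top}) / D̂(k)_{ab} → 0`**: the surface contacts of a long critical width-two
  bridge concentrate at `((3 − √2)/4)·n = 0.3964…·n`.

Label: LANE THEOREM (own result of lane «pcv-sawmu», a-p2 g24, 2026-08-27); classical template = Feller XIII.6 + Chebyshev.  NOT claimed: `hC2` for any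
`T ≥ 3` (it would follow from analyticity of the irreducible kernel at `y_T`, which the tree does not have), a CLT, the linear variance law, β-walks, `T = 1`.
-/

noncomputable section

namespace Literature.Probability.RandomPlanarGeometry.SAW

open Finset Filter Topology Matrix BigOperators
open Literature.Analysis.Matrix Literature.Probability.Process

namespace HV

variable {T : ℕ}

/-! ### §1 Differentiating the contact slices once more: `y ∂_y Σ #top·wD = Σ #top²·wD` -/

section Deriv

/-- `k · y^{k−1} · y = k · y^k` (plumbing; the tree's copy is private). [cite: Feller1968, XIII.6; lane plumbing a-p2 g24] -/
private theorem natMul_pow_pred_mul' (k : ℕ) (y : ℝ) : (k : ℝ) * y ^ (k - 1) * y = (k : ℝ) * y ^ k := by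
  rcases k with _ | k
  · simp
  · rw [Nat.add_sub_cancel, mul_assoc, ← pow_succ]

/-- The contact-weighted slice `Σ_{l∈S} #top·wD(y)` is differentiable in `y`, derivative `Σ #top·x_c^{|l|−1}·#top·y^{#top−1}` (plumbing).
[cite: DuminilCopinHammond2013, §2.2; lane plumbing a-p2 g24] -/
theorem hasDerivAt_contactSum (S : Finset (List HV)) (y : ℝ) :
    HasDerivAt (fun y => ∑ l ∈ S, (topCnt T l.tail : ℝ) * wD T y l)
      (∑ l ∈ S, (topCnt T l.tail : ℝ) * (hexCriticalFugacity ^ (l.length - 1) * ((topCnt T l.tail : ℝ) * y ^ (topCnt T l.tail - 1)))) y := by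
  unfold wD
  exact HasDerivAt.fun_sum fun l _ => ((hasDerivAt_pow _ y).const_mul _).const_mul _

/-- `y · ∂_y Σ #top·wD = Σ #top²·wD` (plumbing). [cite: DuminilCopinHammond2013, §2.2; lane plumbing a-p2 g24] -/
theorem mul_derivContactSum_eq (S : Finset (List HV)) (y : ℝ) :
    y * ∑ l ∈ S, (topCnt T l.tail : ℝ) * (hexCriticalFugacity ^ (l.length - 1) * ((topCnt T l.tail : ℝ) * y ^ (topCnt T l.tail - 1))) =
      ∑ l ∈ S, (topCnt T l.tail : ℝ) ^ 2 * wD T y l := by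
  rw [mul_sum]
  refine sum_congr rfl fun l _ => ?_
  unfold wD
  calc y * ((topCnt T l.tail : ℝ) * (hexCriticalFugacity ^ (l.length - 1) * ((topCnt T l.tail : ℝ) * y ^ (topCnt T l.tail - 1))))
      = (topCnt T l.tail : ℝ) * hexCriticalFugacity ^ (l.length - 1) * ((topCnt T l.tail : ℝ) * y ^ (topCnt T l.tail - 1) * y) := by ring
    _ = _ := by rw [natMul_pow_pred_mul']; ring

end Deriv

/-! ### §2 The second-moment recursion of the contacts: `y∂_y` of the derived renewal equation -/

section SecondMoment

/-- ★★ **THE SECOND-MOMENT CONTACT RECURSION** (`y > 0`).  With the hat slices `Ĉ_X(k)_{ab} = Σ #top·wD` and `Ĉ²_X(k)_{ab} = Σ #top²·wD` over the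
bridges (`X = D`) / irreducible bridges (`X = M`) `a → b` with `n_k` steps:
`Ĉ²_D(k) = Ĉ²_M(k) + Σ_{i+j=k} ( Ĉ²_M(i)D̂(j) + 2·Ĉ_M(i)Ĉ_D(j) + M̂(i)Ĉ²_D(j) )`
— `y∂_y` applied to the tree's derived renewal equation `hat_contact_ren` (`(c₁ + c₂)² = c₁² + 2c₁c₂ + c₂²`: the contacts of a bridge are those of its
first piece plus those of the rest). [cite: Feller1968, XIII.6 (second moments by the renewal argument); DuminilCopinHammond2013, §2.2; lane «pcv-sawmu» a-p2 g24 — own] -/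
theorem hat_contactSq_ren {y : ℝ} (hy : 0 < y) (k : ℕ) :
    (Matrix.of fun a b : Fin (2 * T) => ∑ l ∈ LUset T (2 * k + 1) (hatLen k a b) (a : ℕ) (b : ℕ), (topCnt T l.tail : ℝ) ^ 2 * wD T y l) =
      (Matrix.of fun a b : Fin (2 * T) => ∑ l ∈ LMset T (2 * k + 1) (hatLen k a b) (a : ℕ) (b : ℕ), (topCnt T l.tail : ℝ) ^ 2 * wD T y l) +
        ∑ p ∈ antidiagonal k,
          ((Matrix.of fun a b : Fin (2 * T) => ∑ l ∈ LMset T (2 * p.1 + 1) (hatLen p.1 a b) (a : ℕ) (b : ℕ), (topCnt T l.tail : ℝ) ^ 2 * wD T y l) *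
              hatD T y p.2 +
            (2 : ℝ) • ((Matrix.of fun a b : Fin (2 * T) => ∑ l ∈ LMset T (2 * p.1 + 1) (hatLen p.1 a b) (a : ℕ) (b : ℕ),
                (topCnt T l.tail : ℝ) * wD T y l) *
              (Matrix.of fun a b : Fin (2 * T) => ∑ l ∈ LUset T (2 * p.2 + 1) (hatLen p.2 a b) (a : ℕ) (b : ℕ),
                (topCnt T l.tail : ℝ) * wD T y l)) +
            hatM T y p.1 *
              (Matrix.of fun a b : Fin (2 * T) => ∑ l ∈ LUset T (2 * p.2 + 1) (hatLen p.2 a b) (a : ℕ) (b : ℕ), (topCnt T l.tail : ℝ) ^ 2 * wD T y l)) := by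
  ext a b
  -- the four families of derivative sums
  set dU : ℕ → Fin (2 * T) → Fin (2 * T) → ℝ → ℝ := fun k c d y =>
    ∑ l ∈ LUset T (2 * k + 1) (hatLen k c d) (c : ℕ) (d : ℕ), hexCriticalFugacity ^ (l.length - 1) * ((topCnt T l.tail : ℝ) * y ^ (topCnt T l.tail - 1))
    with hdU
  set dM : ℕ → Fin (2 * T) → Fin (2 * T) → ℝ → ℝ := fun k c d y =>
    ∑ l ∈ LMset T (2 * k + 1) (hatLen k c d) (c : ℕ) (d : ℕ), hexCriticalFugacity ^ (l.length - 1) * ((topCnt T l.tail : ℝ) * y ^ (topCnt T l.tail - 1))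
    with hdM
  set dCU : ℕ → Fin (2 * T) → Fin (2 * T) → ℝ → ℝ := fun k c d y =>
    ∑ l ∈ LUset T (2 * k + 1) (hatLen k c d) (c : ℕ) (d : ℕ),
      (topCnt T l.tail : ℝ) * (hexCriticalFugacity ^ (l.length - 1) * ((topCnt T l.tail : ℝ) * y ^ (topCnt T l.tail - 1))) with hdCU
  set dCM : ℕ → Fin (2 * T) → Fin (2 * T) → ℝ → ℝ := fun k c d y =>
    ∑ l ∈ LMset T (2 * k + 1) (hatLen k c d) (c : ℕ) (d : ℕ),
      (topCnt T l.tail : ℝ) * (hexCriticalFugacity ^ (l.length - 1) * ((topCnt T l.tail : ℝ) * y ^ (topCnt T l.tail - 1))) with hdCM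
  -- the contact slices as functions of `y`
  set CU : ℕ → Fin (2 * T) → Fin (2 * T) → ℝ → ℝ := fun k c d y =>
    ∑ l ∈ LUset T (2 * k + 1) (hatLen k c d) (c : ℕ) (d : ℕ), (topCnt T l.tail : ℝ) * wD T y l with hCU
  set CM : ℕ → Fin (2 * T) → Fin (2 * T) → ℝ → ℝ := fun k c d y =>
    ∑ l ∈ LMset T (2 * k + 1) (hatLen k c d) (c : ℕ) (d : ℕ), (topCnt T l.tail : ℝ) * wD T y l with hCM
  have hF : HasDerivAt (fun y => CU k a b y) (dCU k a b y) y := hasDerivAt_contactSum _ y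
  have hG : HasDerivAt (fun y => CM k a b y + ∑ p ∈ antidiagonal k, ∑ c : Fin (2 * T),
      (CM p.1 a c y * hatD T y p.2 c b + hatM T y p.1 a c * CU p.2 c b y))
      (dCM k a b y + ∑ p ∈ antidiagonal k, ∑ c : Fin (2 * T),
        ((dCM p.1 a c y * hatD T y p.2 c b + CM p.1 a c y * dU p.2 c b y) +
          (dM p.1 a c y * CU p.2 c b y + hatM T y p.1 a c * dCU p.2 c b y))) y := by
    refine (hasDerivAt_contactSum _ y).add (HasDerivAt.fun_sum fun p _ => HasDerivAt.fun_sum fun c _ => ?_)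
    exact ((hasDerivAt_contactSum (T := T) _ y).fun_mul (hasDerivAt_LUs (T := T) (2 * p.2 + 1) (hatLen p.2 c b) (c : ℕ) (b : ℕ) y)).add
      ((hasDerivAt_LMs (T := T) (2 * p.1 + 1) (hatLen p.1 a c) (a : ℕ) (c : ℕ) y).fun_mul (hasDerivAt_contactSum (T := T) _ y))
  have hFG : (fun y => CM k a b y + ∑ p ∈ antidiagonal k, ∑ c : Fin (2 * T),
      (CM p.1 a c y * hatD T y p.2 c b + hatM T y p.1 a c * CU p.2 c b y)) =ᶠ[𝓝 y] (fun y => CU k a b y) := by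
    filter_upwards [Ioi_mem_nhds hy] with y' hy'
    have h := congr_fun (congr_fun (hat_contact_ren (T := T) hy' k) a) b
    rw [Matrix.add_apply, Matrix.sum_apply] at h
    simp only [Matrix.of_apply, Matrix.add_apply, Matrix.mul_apply, ← sum_add_distrib] at h
    rw [hCU, hCM]
    simp only
    rw [h]
  have huniq := hF.unique (hG.congr_of_eventuallyEq hFG.symm)
  -- conversions `y · (derivative sum) = weighted slice`
  have hU : ∀ k (c d : Fin (2 * T)), y * dU k c d y = CU k c d y := fun k c d => mul_derivSum_eq_contactSum _ y
  have hM : ∀ k (c d : Fin (2 * T)), y * dM k c d y = CM k c d y := fun k c d => mul_derivSum_eq_contactSum _ y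
  have hCU2 : ∀ k (c d : Fin (2 * T)), y * dCU k c d y =
      ∑ l ∈ LUset T (2 * k + 1) (hatLen k c d) (c : ℕ) (d : ℕ), (topCnt T l.tail : ℝ) ^ 2 * wD T y l :=
    fun k c d => mul_derivContactSum_eq _ y
  have hCM2 : ∀ k (c d : Fin (2 * T)), y * dCM k c d y =
      ∑ l ∈ LMset T (2 * k + 1) (hatLen k c d) (c : ℕ) (d : ℕ), (topCnt T l.tail : ℝ) ^ 2 * wD T y l :=
    fun k c d => mul_derivContactSum_eq _ y
  rw [Matrix.add_apply, Matrix.sum_apply]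
  simp only [Matrix.of_apply, Matrix.add_apply, Matrix.mul_apply, Matrix.smul_apply, smul_eq_mul]
  rw [← hCU2, ← hCM2, huniq, mul_add]
  congr 1
  rw [Finset.mul_sum (antidiagonal k)]
  refine sum_congr rfl fun p _ => ?_
  rw [Finset.mul_sum Finset.univ, Finset.mul_sum Finset.univ, ← sum_add_distrib, ← sum_add_distrib]
  refine sum_congr rfl fun c _ => ?_
  have hU' : ∀ k (c d : Fin (2 * T)), (∑ l ∈ LUset T (2 * k + 1) (hatLen k c d) (c : ℕ) (d : ℕ), (topCnt T l.tail : ℝ) * wD T y l) =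
      y * dU k c d y := fun k c d => (hU k c d).symm
  have hM' : ∀ k (c d : Fin (2 * T)), (∑ l ∈ LMset T (2 * k + 1) (hatLen k c d) (c : ℕ) (d : ℕ), (topCnt T l.tail : ℝ) * wD T y l) =
      y * dM k c d y := fun k c d => (hM k c d).symm
  rw [← hU, ← hM, ← hCU2, ← hCM2, hU' p.2 c b, hM' p.1 a c]
  ring

end SecondMoment

/-! ### §3 ★★★★ The second contact moment per step² tends to `θ_T²` (given a finite second contact moment of the kernel); variance; weak law -/

section LLN

variable {u ℓ : Fin (2 * T) → ℝ}

/-- `0 ≤ Ĉ²_D(k) ≤ (2k+1)²·D̂(k)` and `0 ≤ Ĉ²_M(k)` (a bridge with `n` steps has at most `n` contacts; plumbing). [cite: DuminilCopinHammond2013, §2.2; lane plumbing a-p2 g24] -/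
theorem hat_contactSqSlices_facts (hT : 2 ≤ T) (k : ℕ) (a b : Fin (2 * T)) :
    (0 ≤ ∑ l ∈ LUset T (2 * k + 1) (hatLen k a b) (a : ℕ) (b : ℕ), (topCnt T l.tail : ℝ) ^ 2 * wD T (stripYT T) l ∧
      ∑ l ∈ LUset T (2 * k + 1) (hatLen k a b) (a : ℕ) (b : ℕ), (topCnt T l.tail : ℝ) ^ 2 * wD T (stripYT T) l ≤
        (2 * k + 1) ^ 2 * hatD T (stripYT T) k a b) ∧
      0 ≤ ∑ l ∈ LMset T (2 * k + 1) (hatLen k a b) (a : ℕ) (b : ℕ), (topCnt T l.tail : ℝ) ^ 2 * wD T (stripYT T) l := by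
  have hy := (stripYT_pos (show 1 ≤ T by omega)).le
  have h0 : ∀ l : List HV, 0 ≤ (topCnt T l.tail : ℝ) ^ 2 * wD T (stripYT T) l := fun l => mul_nonneg (sq_nonneg _) (wD_nonneg T hy _)
  refine ⟨⟨sum_nonneg fun l _ => h0 l, ?_⟩, sum_nonneg fun l _ => h0 l⟩
  rw [hatD, LUM, LUs, mul_sum]
  refine sum_le_sum fun l hl => mul_le_mul_of_nonneg_right ?_ (wD_nonneg T hy _)
  obtain ⟨-, -, -, -, -, -, h2, -, -, hsz⟩ := of_mem_LUset hl
  have hχa := (lchi_facts a).1; have hχb := (lchi_facts b).1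
  have h1 : topCnt T l.tail ≤ l.tail.length := topCnt_le_length T l.tail
  rw [List.length_tail] at h1
  have h3 : (topCnt T l.tail : ℝ) ≤ 2 * k + 1 := by
    have : topCnt T l.tail ≤ 2 * k + 1 := by unfold hlen at hsz; unfold hatLen at hsz; omega
    exact_mod_cast this
  have h4 : 0 ≤ (topCnt T l.tail : ℝ) := Nat.cast_nonneg _
  nlinarith

/-- ★★★★ **THE SECOND CONTACT MOMENT OF LONG CRITICAL BRIDGES** (`T ≥ 2`), CONDITIONAL on a finite second contact moment of the critical irreducible kernel
along the hat classes (`hC2`: `Σ_k Ĉ²_M(k)_{ab} < ∞` for all `a, b` — true at `T = 2`, open for `T ≥ 3`).  For all levels `a, b`, along `n_k = 2k + χ_a − χ_b`,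
with `Ĉ²_D(k)_{ab} = Σ_{bridges a→b, n_k steps} #top²·x_c^{n_k}y_T^{#top}` and `u`, `ℓ` any positive fixed vectors of `Iinf T y_T`:
`Ĉ²_D(k)_{ab}/(n_k² · D̂(k)_{ab}) ⟶ θ_T²`, `θ_T = ⟨ℓ, C̄_M u⟩/⟨ℓ, M̄_len u⟩` (the contact density of #687).
By `RenewalKernelPair.tendsto_S2_div_sq_D` for the contact reward pair `(Ĉ_M, Ĉ_D)` of #687 (rebuilt here) with `(R₂, S₂) = (Ĉ²_M, Ĉ²_D)` tied by `hat_contactSq_ren`.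
[cite: Feller1968, XIII.6 (mean and variance of the number of renewals); DuminilCopinHammond2013, §2.2; BeatonBousquetMelouDeGierDuminilCopinGuttmann2014, Cor. 8 (y_T); lane «pcv-sawmu» a-p2 g24 — own result] -/
theorem tendsto_contactSq_per_step_sq (hT : 2 ≤ T) (hu0 : ∀ a, 0 < u a) (hℓ0 : ∀ b, 0 < ℓ b)
    (hu : Iinf T (stripYT T) *ᵥ u = u) (hℓ : ℓ ᵥ* Iinf T (stripYT T) = ℓ)
    (hC2 : ∀ a b : Fin (2 * T), Summable fun k : ℕ =>
      ∑ l ∈ LMset T (2 * k + 1) (hatLen k a b) (a : ℕ) (b : ℕ), (topCnt T l.tail : ℝ) ^ 2 * wD T (stripYT T) l)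
    (a b : Fin (2 * T)) :
    Tendsto (fun k : ℕ => (∑ l ∈ LUset T (2 * k + 1) (hatLen k a b) (a : ℕ) (b : ℕ), (topCnt T l.tail : ℝ) ^ 2 * wD T (stripYT T) l) /
        ((hatLen k a b : ℝ) ^ 2 * hatD T (stripYT T) k a b)) atTop
      (𝓝 (((ℓ ⬝ᵥ ((Matrix.of fun c d : Fin (2 * T) =>
          ∑' n : ℕ, ∑ l ∈ LMset T n (n : ℤ) (c : ℕ) (d : ℕ), (topCnt T l.tail : ℝ) * wD T (stripYT T) l) *ᵥ u)) /
        (ℓ ⬝ᵥ ((Matrix.of fun a b : Fin (2 * T) => ∑' n : ℕ, (n : ℝ) * LMM T n (n : ℤ) (stripYT T) a b) *ᵥ u))) ^ 2)) := by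
  have hT1 : 1 ≤ T := by omega
  have hyT : 0 < stripYT T := stripYT_pos hT1
  obtain ⟨hl, hL⟩ := tendsto_stripLenD_residue_explicit hT hu0 hℓ0 hu hℓ
  set dl := ℓ ⬝ᵥ ((Matrix.of fun a b : Fin (2 * T) => ∑' n : ℕ, (n : ℝ) * LMM T n (n : ℤ) (stripYT T) a b) *ᵥ u) with hdl
  have hres : ∀ a b, Tendsto (fun s : ℝ => (1 - s) * stripLenD T s a b) (𝓝[<] 1) (𝓝 (1 / dl * (u a * ℓ b))) := fun a b => by
    have := hL a b; rwa [show u a * ℓ b / dl = 1 / dl * (u a * ℓ b) by ring] at this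
  have hcrit := hatPair_critical hT hu0 hℓ0 (one_div_pos.2 hl) hres
  set K := hatPair T hyT.le with hK
  -- the contact reward pair `(Ĉ_M, Ĉ_D)` (as in the tree's `tendsto_hat_contacts_div`)
  let W : RenewalKernelPair.RewardPair K :=
    { R := fun k => Matrix.of fun a b : Fin (2 * T) =>
        ∑ l ∈ LMset T (2 * k + 1) (hatLen k a b) (a : ℕ) (b : ℕ), (topCnt T l.tail : ℝ) * wD T (stripYT T) l
      S := fun k => Matrix.of fun a b : Fin (2 * T) =>
        ∑ l ∈ LUset T (2 * k + 1) (hatLen k a b) (a : ℕ) (b : ℕ), (topCnt T l.tail : ℝ) * wD T (stripYT T) l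
      R_nonneg := fun k a b => (hat_contactSlices_facts hT k a b).2
      S_nonneg := fun k a b => (hat_contactSlices_facts hT k a b).1.1
      ren := fun k => hat_contact_ren hyT k
      summable_R := fun a b => (hasSum_hat_contactIrr hT a b).summable
      summable_S := fun a b s hs0 hs1 => by
        obtain ⟨B, hB⟩ := (K.tendsto_coeff hcrit a b).bddAbove_range
        have hB' : ∀ k, hatD T (stripYT T) k a b ≤ B := fun k => hB ⟨k, rfl⟩
        have hB0 : 0 ≤ B := (LMM_LUM_nonneg hyT.le _ a b).2.trans (hB' 0)
        have hg : Summable fun k : ℕ => (2 * k + 1) * B * s ^ k := by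
          have h1 : Summable fun k : ℕ => (k : ℝ) * s ^ k := by
            have := summable_pow_mul_geometric_of_norm_lt_one 1 (show ‖s‖ < 1 by rw [Real.norm_eq_abs, abs_of_nonneg hs0]; exact hs1)
            simpa using this
          have h2 : Summable fun k : ℕ => s ^ k := summable_geometric_of_lt_one hs0 hs1
          have : (fun k : ℕ => (2 * k + 1) * B * s ^ k) = fun k : ℕ => 2 * B * ((k : ℝ) * s ^ k) + B * s ^ k := by
            funext k; ring
          rw [this]
          exact (h1.mul_left _).add (h2.mul_left _)
        refine hg.of_nonneg_of_le (fun k => mul_nonneg (hat_contactSlices_facts hT k a b).1.1 (pow_nonneg hs0 _)) fun k => ?_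
        simp only [Matrix.of_apply]
        refine mul_le_mul_of_nonneg_right ?_ (pow_nonneg hs0 _)
        exact (hat_contactSlices_facts hT k a b).1.2.trans (mul_le_mul_of_nonneg_left (hB' k) (by positivity)) }
  -- the abstract second-moment theorem with `(R₂, S₂) = (Ĉ²_M, Ĉ²_D)`
  have hQ := RenewalKernelPair.tendsto_S2_div_sq_D hcrit W
    (fun k => Matrix.of fun a b : Fin (2 * T) =>
      ∑ l ∈ LMset T (2 * k + 1) (hatLen k a b) (a : ℕ) (b : ℕ), (topCnt T l.tail : ℝ) ^ 2 * wD T (stripYT T) l)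
    (fun k => Matrix.of fun a b : Fin (2 * T) =>
      ∑ l ∈ LUset T (2 * k + 1) (hatLen k a b) (a : ℕ) (b : ℕ), (topCnt T l.tail : ℝ) ^ 2 * wD T (stripYT T) l)
    (fun k a b => (hat_contactSqSlices_facts hT k a b).2) hC2 (fun k => by rw [hat_contactSq_ren hyT k]; rfl) a a b
  -- identify the constant: `(Σ_d (Σ_c L̂_{ac} R̄_{cd}) L̂_{da})/L̂_{aa} = 2⟨ℓ, C̄_M u⟩/dl`
  have hR : ∀ c d : Fin (2 * T), ∑' j : ℕ, W.R j c d =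
      ∑' n : ℕ, ∑ l ∈ LMset T n (n : ℤ) (c : ℕ) (d : ℕ), (topCnt T l.tail : ℝ) * wD T (stripYT T) l := fun c d =>
    (hasSum_hat_contactIrr hT c d).tsum_eq
  set CM := (Matrix.of fun c d : Fin (2 * T) =>
    ∑' n : ℕ, ∑ l ∈ LMset T n (n : ℤ) (c : ℕ) (d : ℕ), (topCnt T l.tail : ℝ) * wD T (stripYT T) l) with hCM
  have hval : (∑ d, (∑ c, 2 * (1 / dl * (u a * ℓ c)) * ∑' j : ℕ, W.R j c d) * (2 * (1 / dl * (u d * ℓ a)))) /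
      (2 * (1 / dl * (u a * ℓ a))) = 2 * ((ℓ ⬝ᵥ (CM *ᵥ u)) / dl) := by
    simp_rw [hR]
    have hne : 2 * (1 / dl * (u a * ℓ a)) ≠ 0 := by have := hu0 a; have := hℓ0 a; positivity
    rw [div_eq_iff hne]
    simp only [Matrix.mulVec, dotProduct, hCM, Matrix.of_apply, div_eq_mul_inv, sum_mul, mul_sum]
    rw [Finset.sum_comm]
    refine sum_congr rfl fun c _ => sum_congr rfl fun d _ => ?_
    have hdl0 : dl ≠ 0 := hl.ne'
    field_simp
  simp only [Matrix.of_apply] at hQ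
  rw [hval] at hQ
  -- from `(k+1)²` to `n_k²`
  have h2 := (tendsto_succ_div_hatLen_half (T := T) a b).pow 2
  have h := hQ.mul h2
  have hlimval : (2 * ((ℓ ⬝ᵥ (CM *ᵥ u)) / dl)) ^ 2 * (1 / 2) ^ 2 = ((ℓ ⬝ᵥ (CM *ᵥ u)) / dl) ^ 2 := by ring
  rw [hlimval] at h
  refine h.congr' ?_
  have hden : Tendsto (fun k : ℕ => (hatLen k a b : ℝ)) atTop atTop := by
    have hL' : ∀ k : ℕ, (hatLen k a b : ℝ) = 2 * (k : ℝ) + ((lchi a - lchi b : ℤ) : ℝ) := fun k => by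
      unfold hatLen; push_cast; ring
    simp_rw [hL']
    exact (tendsto_natCast_atTop_atTop.const_mul_atTop two_pos).atTop_add tendsto_const_nhds
  have hKD : ∀ k, K.D k a b = hatD T (stripYT T) k a b := fun k => rfl
  filter_upwards [hden.eventually_gt_atTop 0] with k hk
  have hk1 : (k : ℝ) + 1 ≠ 0 := by positivity
  rw [hKD k]
  by_cases hD : hatD T (stripYT T) k a b = 0
  · simp [hD]
  · field_simp

/-- ★★★★ **THE VARIANCE OF THE CONTACT DENSITY VANISHES** (`T ≥ 2`, conditional on `hC2` as above): along `n_k`, with `θ_T` the contact density,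
`Σ_{bridges a→b, n_k steps} (#top − θ_T·n_k)²·wD / (n_k²·D̂(k)_{ab}) ⟶ 0` — `E[(#top/n − θ_T)²] → 0` under the critical bridge weighting.
[cite: Feller1968, XIII.6; DuminilCopinHammond2013, §2.2; lane «pcv-sawmu» a-p2 g24 — own result] -/
theorem tendsto_contacts_variance (hT : 2 ≤ T) (hu0 : ∀ a, 0 < u a) (hℓ0 : ∀ b, 0 < ℓ b)
    (hu : Iinf T (stripYT T) *ᵥ u = u) (hℓ : ℓ ᵥ* Iinf T (stripYT T) = ℓ)
    (hC2 : ∀ a b : Fin (2 * T), Summable fun k : ℕ =>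
      ∑ l ∈ LMset T (2 * k + 1) (hatLen k a b) (a : ℕ) (b : ℕ), (topCnt T l.tail : ℝ) ^ 2 * wD T (stripYT T) l)
    (a b : Fin (2 * T)) :
    Tendsto (fun k : ℕ => (∑ l ∈ LUset T (2 * k + 1) (hatLen k a b) (a : ℕ) (b : ℕ),
          ((topCnt T l.tail : ℝ) - (ℓ ⬝ᵥ ((Matrix.of fun c d : Fin (2 * T) =>
              ∑' n : ℕ, ∑ l ∈ LMset T n (n : ℤ) (c : ℕ) (d : ℕ), (topCnt T l.tail : ℝ) * wD T (stripYT T) l) *ᵥ u)) /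
            (ℓ ⬝ᵥ ((Matrix.of fun a b : Fin (2 * T) => ∑' n : ℕ, (n : ℝ) * LMM T n (n : ℤ) (stripYT T) a b) *ᵥ u)) *
              (hatLen k a b : ℝ)) ^ 2 * wD T (stripYT T) l) /
        ((hatLen k a b : ℝ) ^ 2 * hatD T (stripYT T) k a b)) atTop (𝓝 0) := by
  set θ : ℝ := (ℓ ⬝ᵥ ((Matrix.of fun c d : Fin (2 * T) =>
      ∑' n : ℕ, ∑ l ∈ LMset T n (n : ℤ) (c : ℕ) (d : ℕ), (topCnt T l.tail : ℝ) * wD T (stripYT T) l) *ᵥ u)) /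
    (ℓ ⬝ᵥ ((Matrix.of fun a b : Fin (2 * T) => ∑' n : ℕ, (n : ℝ) * LMM T n (n : ℤ) (stripYT T) a b) *ᵥ u)) with hθ
  set S := fun k : ℕ => LUset T (2 * k + 1) (hatLen k a b) (a : ℕ) (b : ℕ) with hS
  set w := fun l : List HV => wD T (stripYT T) l with hw
  have hQ := tendsto_contactSq_per_step_sq hT hu0 hℓ0 hu hℓ hC2 a b
  have hP := tendsto_contacts_per_step_pointwise hT hu0 hℓ0 hu hℓ a b
  rw [← hθ] at hQ hP
  have hden : Tendsto (fun k : ℕ => (hatLen k a b : ℝ)) atTop atTop := by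
    have hL : ∀ k : ℕ, (hatLen k a b : ℝ) = 2 * (k : ℝ) + ((lchi a - lchi b : ℤ) : ℝ) := fun k => by
      unfold hatLen; push_cast; ring
    simp_rw [hL]
    exact (tendsto_natCast_atTop_atTop.const_mul_atTop two_pos).atTop_add tendsto_const_nhds
  -- `C²/(n²D) − 2θ (C/(nD)) + θ²·1 → θ² − 2θ² + θ² = 0`
  have hlim : Tendsto (fun k : ℕ =>
      (∑ l ∈ S k, (topCnt T l.tail : ℝ) ^ 2 * w l) / ((hatLen k a b : ℝ) ^ 2 * hatD T (stripYT T) k a b) -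
        2 * θ * ((∑ l ∈ S k, (topCnt T l.tail : ℝ) * w l) / ((hatLen k a b : ℝ) * hatD T (stripYT T) k a b)) + θ ^ 2)
      atTop (𝓝 (θ ^ 2 - 2 * θ * θ + θ ^ 2)) :=
    (hQ.sub (hP.const_mul (2 * θ))).add tendsto_const_nhds
  have hzero : θ ^ 2 - 2 * θ * θ + θ ^ 2 = 0 := by ring
  rw [hzero] at hlim
  -- eventually `D̂ > 0`
  have hT1 : 1 ≤ T := by omega
  have hyT : 0 < stripYT T := stripYT_pos hT1
  obtain ⟨hl, hL⟩ := tendsto_stripLenD_residue_explicit hT hu0 hℓ0 hu hℓ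
  have hres : ∀ a b, Tendsto (fun s : ℝ => (1 - s) * stripLenD T s a b) (𝓝[<] 1)
      (𝓝 (1 / (ℓ ⬝ᵥ ((Matrix.of fun a b : Fin (2 * T) => ∑' n : ℕ, (n : ℝ) * LMM T n (n : ℤ) (stripYT T) a b) *ᵥ u)) *
        (u a * ℓ b))) := fun a b => by
    have := hL a b
    rwa [show u a * ℓ b / _ = 1 / (ℓ ⬝ᵥ ((Matrix.of fun a b : Fin (2 * T) => ∑' n : ℕ, (n : ℝ) * LMM T n (n : ℤ) (stripYT T) a b) *ᵥ u)) *
      (u a * ℓ b) by ring] at this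
  have hcrit := hatPair_critical hT hu0 hℓ0 (one_div_pos.2 hl) hres
  have hDlim := (hatPair T hyT.le).tendsto_coeff hcrit a b
  have hDpos : ∀ᶠ k : ℕ in atTop, 0 < hatD T (stripYT T) k a b := by
    have hpos : 0 < 2 * (1 / (ℓ ⬝ᵥ ((Matrix.of fun a b : Fin (2 * T) => ∑' n : ℕ, (n : ℝ) * LMM T n (n : ℤ) (stripYT T) a b) *ᵥ u)) *
        (u a * ℓ b)) := by have := hu0 a; have := hℓ0 b; positivity
    exact hDlim.eventually (eventually_gt_nhds hpos)
  refine hlim.congr' ?_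
  filter_upwards [hden.eventually_gt_atTop 0, hDpos] with k hk hDk
  have hn0 : (hatLen k a b : ℝ) ≠ 0 := hk.ne'
  have hD0 : hatD T (stripYT T) k a b ≠ 0 := hDk.ne'
  have hsum : ∑ l ∈ S k, ((topCnt T l.tail : ℝ) - θ * (hatLen k a b : ℝ)) ^ 2 * w l =
      ∑ l ∈ S k, (topCnt T l.tail : ℝ) ^ 2 * w l - 2 * θ * (hatLen k a b : ℝ) * ∑ l ∈ S k, (topCnt T l.tail : ℝ) * w l +
        θ ^ 2 * (hatLen k a b : ℝ) ^ 2 * ∑ l ∈ S k, w l := by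
    rw [mul_sum, mul_sum, ← sum_sub_distrib, ← sum_add_distrib]
    exact sum_congr rfl fun l _ => by ring
  have hDsum : hatD T (stripYT T) k a b = ∑ l ∈ S k, w l := by rw [hatD, LUM, LUs]
  rw [hsum, hDsum]
  rw [hDsum] at hD0
  field_simp

/-- ★★★★ **WEAK LAW FOR THE SURFACE CONTACTS OF A LONG CRITICAL BRIDGE** (`T ≥ 2`; conditional on the second contact moment `hC2`; Chebyshev).
For all levels `a, b`, every `ε > 0`, along `n_k`: the critical weight of the bridges `a → b` with `n_k` steps whose number of surface contacts per step
deviates from `θ_T` by at least `ε`, divided by `D̂(k)_{ab}`, tends to `0`. [cite: Feller1968, XIII.6 (variance; Chebyshev); DuminilCopinHammond2013, §2.2; BeatonBousquetMelouDeGierDuminilCopinGuttmann2014, Cor. 8; lane «pcv-sawmu» a-p2 g24 — own result, not in print] -/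
theorem tendsto_contacts_deviation (hT : 2 ≤ T) (hu0 : ∀ a, 0 < u a) (hℓ0 : ∀ b, 0 < ℓ b)
    (hu : Iinf T (stripYT T) *ᵥ u = u) (hℓ : ℓ ᵥ* Iinf T (stripYT T) = ℓ)
    (hC2 : ∀ a b : Fin (2 * T), Summable fun k : ℕ =>
      ∑ l ∈ LMset T (2 * k + 1) (hatLen k a b) (a : ℕ) (b : ℕ), (topCnt T l.tail : ℝ) ^ 2 * wD T (stripYT T) l)
    (a b : Fin (2 * T)) {ε : ℝ} (hε : 0 < ε) :
    Tendsto (fun k : ℕ => (∑ l ∈ (LUset T (2 * k + 1) (hatLen k a b) (a : ℕ) (b : ℕ)).filter (fun l =>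
          ε ≤ |(topCnt T l.tail : ℝ) / (hatLen k a b : ℝ) - (ℓ ⬝ᵥ ((Matrix.of fun c d : Fin (2 * T) =>
              ∑' n : ℕ, ∑ l ∈ LMset T n (n : ℤ) (c : ℕ) (d : ℕ), (topCnt T l.tail : ℝ) * wD T (stripYT T) l) *ᵥ u)) /
            (ℓ ⬝ᵥ ((Matrix.of fun a b : Fin (2 * T) => ∑' n : ℕ, (n : ℝ) * LMM T n (n : ℤ) (stripYT T) a b) *ᵥ u))|),
          wD T (stripYT T) l) / hatD T (stripYT T) k a b) atTop (𝓝 0) := by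
  set θ : ℝ := (ℓ ⬝ᵥ ((Matrix.of fun c d : Fin (2 * T) =>
      ∑' n : ℕ, ∑ l ∈ LMset T n (n : ℤ) (c : ℕ) (d : ℕ), (topCnt T l.tail : ℝ) * wD T (stripYT T) l) *ᵥ u)) /
    (ℓ ⬝ᵥ ((Matrix.of fun a b : Fin (2 * T) => ∑' n : ℕ, (n : ℝ) * LMM T n (n : ℤ) (stripYT T) a b) *ᵥ u)) with hθ
  have hV := tendsto_contacts_variance hT hu0 hℓ0 hu hℓ hC2 a b
  rw [← hθ] at hV
  have hyT : 0 < stripYT T := stripYT_pos (by omega)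
  have hden : Tendsto (fun k : ℕ => (hatLen k a b : ℝ)) atTop atTop := by
    have hL : ∀ k : ℕ, (hatLen k a b : ℝ) = 2 * (k : ℝ) + ((lchi a - lchi b : ℤ) : ℝ) := fun k => by
      unfold hatLen; push_cast; ring
    simp_rw [hL]
    exact (tendsto_natCast_atTop_atTop.const_mul_atTop two_pos).atTop_add tendsto_const_nhds
  have hup := hV.const_mul (1 / ε ^ 2)
  rw [mul_zero] at hup
  refine tendsto_of_tendsto_of_tendsto_of_le_of_le' tendsto_const_nhds hup ?_ ?_
  · filter_upwards with k
    exact div_nonneg (sum_nonneg fun l _ => wD_nonneg T hyT.le _) (LMM_LUM_nonneg hyT.le _ a b).2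
  · filter_upwards [hden.eventually_gt_atTop 0] with k hk
    set n : ℝ := (hatLen k a b : ℝ) with hn
    set S := LUset T (2 * k + 1) (hatLen k a b) (a : ℕ) (b : ℕ) with hS
    have hD0 : 0 ≤ hatD T (stripYT T) k a b := (LMM_LUM_nonneg hyT.le _ a b).2
    have hpt : ∀ l ∈ S, ε ≤ |(topCnt T l.tail : ℝ) / n - θ| →
        wD T (stripYT T) l ≤ (1 / ε ^ 2) * (((topCnt T l.tail : ℝ) - θ * n) ^ 2 * wD T (stripYT T) l / n ^ 2) := by
      intro l _ hbad
      have hw0 := wD_nonneg T hyT.le l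
      have hdev : ε ^ 2 ≤ ((topCnt T l.tail : ℝ) / n - θ) ^ 2 := by
        calc ε ^ 2 = |ε| ^ 2 := by rw [abs_of_pos hε]
          _ ≤ |(topCnt T l.tail : ℝ) / n - θ| ^ 2 := pow_le_pow_left₀ (abs_nonneg ε) (by rwa [abs_of_pos hε]) 2
          _ = ((topCnt T l.tail : ℝ) / n - θ) ^ 2 := sq_abs _
      have hid : ((topCnt T l.tail : ℝ) - θ * n) ^ 2 * wD T (stripYT T) l / n ^ 2 =
          ((topCnt T l.tail : ℝ) / n - θ) ^ 2 * wD T (stripYT T) l := by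
        field_simp
      have h1 : ε ^ 2 * wD T (stripYT T) l ≤ ((topCnt T l.tail : ℝ) / n - θ) ^ 2 * wD T (stripYT T) l :=
        mul_le_mul_of_nonneg_right hdev hw0
      calc wD T (stripYT T) l = (1 / ε ^ 2) * (ε ^ 2 * wD T (stripYT T) l) := by field_simp
        _ ≤ (1 / ε ^ 2) * (((topCnt T l.tail : ℝ) / n - θ) ^ 2 * wD T (stripYT T) l) := mul_le_mul_of_nonneg_left h1 (by positivity)
        _ = (1 / ε ^ 2) * (((topCnt T l.tail : ℝ) - θ * n) ^ 2 * wD T (stripYT T) l / n ^ 2) := by rw [hid]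
    calc (∑ l ∈ S.filter (fun l => ε ≤ |(topCnt T l.tail : ℝ) / n - θ|), wD T (stripYT T) l) / hatD T (stripYT T) k a b
        ≤ (∑ l ∈ S.filter (fun l => ε ≤ |(topCnt T l.tail : ℝ) / n - θ|),
            (1 / ε ^ 2) * (((topCnt T l.tail : ℝ) - θ * n) ^ 2 * wD T (stripYT T) l / n ^ 2)) / hatD T (stripYT T) k a b := by
          refine div_le_div_of_nonneg_right (sum_le_sum fun l hl => ?_) hD0
          rw [mem_filter] at hl
          exact hpt l hl.1 hl.2
      _ ≤ (∑ l ∈ S, (1 / ε ^ 2) * (((topCnt T l.tail : ℝ) - θ * n) ^ 2 * wD T (stripYT T) l / n ^ 2)) / hatD T (stripYT T) k a b := by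
          refine div_le_div_of_nonneg_right (sum_le_sum_of_subset_of_nonneg (filter_subset _ _) fun l _ _ => ?_) hD0
          have := wD_nonneg T hyT.le l
          positivity
      _ = (1 / ε ^ 2) * ((∑ l ∈ S, ((topCnt T l.tail : ℝ) - θ * n) ^ 2 * wD T (stripYT T) l) / (n ^ 2 * hatD T (stripYT T) k a b)) := by
          rw [← mul_sum, ← Finset.sum_div, mul_div_assoc, div_div]

end LLN

/-! ### §4 Width two: the hypothesis holds trivially and `θ₂ = (3 − √2)/4` — the surface contacts of a long critical bridge of `S₂` concentrate -/

section WidthTwo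

open W2

/-- At `T = 2` the irreducible second-contact hat slices vanish from `k = 2` on: an irreducible bridge of `S₂` has one or two steps (#715).
[cite: DuminilCopinHammond2013, §2.2; lane «pcv-sawmu» a-p2 g24] -/
theorem widthTwo_contactSqIrr_eq_zero (y : ℝ) {k : ℕ} (hk : 2 ≤ k) (a b : Fin (2 * 2)) :
    (∑ l ∈ LMset 2 (2 * k + 1) (hatLen k a b) (a : ℕ) (b : ℕ), (topCnt 2 l.tail : ℝ) ^ 2 * wD 2 y l) = 0 := by
  refine sum_eq_zero fun l hl => ?_
  exfalso
  rw [LMset, mem_filter] at hl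
  have hχa := (lchi_facts a).1
  have hχb := (lchi_facts b).1
  have hsz := hl.2
  unfold hatLen at hsz
  rcases hlen_of_mem_HBk_two hl.1 with h | h <;> rw [h] at hsz <;> omega

/-- ★ At `T = 2` the second contact moment of the critical irreducible kernel is (trivially) finite along every hat class — the hypothesis `hC2` of §3.
[cite: DuminilCopinHammond2013, §2.2; lane «pcv-sawmu» a-p2 g24] -/
theorem widthTwo_summable_contactSqIrr (a b : Fin (2 * 2)) :
    Summable fun k : ℕ => ∑ l ∈ LMset 2 (2 * k + 1) (hatLen k a b) (a : ℕ) (b : ℕ), (topCnt 2 l.tail : ℝ) ^ 2 * wD 2 (stripYT 2) l := by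
  refine summable_of_ne_finset_zero (s := Finset.range 2) fun k hk => ?_
  rw [Finset.mem_range, not_lt] at hk
  exact widthTwo_contactSqIrr_eq_zero (stripYT 2) hk a b

/-- ★★★★ **WIDTH TWO: THE SURFACE CONTACTS OF A LONG CRITICAL BRIDGE CONCENTRATE AT `(3 − √2)/4 · n`.**  For every pair of levels `a, b` of `S₂`
and every `ε > 0`, along `n_k = 2k + χ_a − χ_b`:
`(Σ_{bridges a→b with n_k steps and |#top/n_k − (3 − √2)/4| ≥ ε} x_c^{n_k} y₂^{#top}) / D̂(k)_{ab} ⟶ 0`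
— unconditional: the weak law of §3 with `widthTwo_summable_contactSqIrr` and the closed-form Perron data of «WIDTH-TWO-KERNEL» (#715:
`⟨ℓ, C̄_M u⟩ = 7`, `⟨ℓ, M̄_len u⟩ = 20 − 8x²`, `7·4 = (3 − √2)(20 − 8x²)`). [cite: Feller1968, XIII.6; DuminilCopinHammond2013, §2.2; BeatonBousquetMelouDeGierDuminilCopinGuttmann2014, Corollary 8 (the strip at (x_c, y_T)); lane «pcv-sawmu» a-p2 g24 — own result, not in print] -/
theorem widthTwo_contacts_deviation (a b : Fin (2 * 2)) {ε : ℝ} (hε : 0 < ε) :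
    Tendsto (fun k : ℕ => (∑ l ∈ (LUset 2 (2 * k + 1) (hatLen k a b) (a : ℕ) (b : ℕ)).filter (fun l =>
          ε ≤ |(topCnt 2 l.tail : ℝ) / (hatLen k a b : ℝ) - (3 - Real.sqrt 2) / 4|), wD 2 (stripYT 2) l) /
        hatD 2 (stripYT 2) k a b) atTop (𝓝 0) := by
  have h := tendsto_contacts_deviation (T := 2) le_rfl uTwo_pos ellTwo_pos Iinf_two_fixed.1 Iinf_two_fixed.2
    widthTwo_summable_contactSqIrr a b hε
  have hval : (ellTwo ⬝ᵥ ((Matrix.of fun c d : Fin (2 * 2) =>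
      ∑' n : ℕ, ∑ l ∈ LMset 2 n (n : ℤ) (c : ℕ) (d : ℕ), (topCnt 2 l.tail : ℝ) * wD 2 (stripYT 2) l) *ᵥ uTwo)) /
      (ellTwo ⬝ᵥ ((Matrix.of fun a b : Fin (2 * 2) => ∑' n : ℕ, (n : ℝ) * LMM 2 n (n : ℤ) (stripYT 2) a b) *ᵥ uTwo)) =
      (3 - Real.sqrt 2) / 4 := by
    rw [contactMomentMatrix_two_eq, lengthMomentMatrix_two_eq, contact_scalar_two.1, perron_scalars_two.2]
    have hpos : 0 < 20 - 8 * hexCriticalFugacity ^ 2 := by nlinarith [xc_sq_bounds.2]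
    have h4 := contact_scalar_two.2
    rw [contact_scalar_two.1, perron_scalars_two.2] at h4
    rw [div_eq_div_iff hpos.ne' (by norm_num : (4 : ℝ) ≠ 0)]
    linarith
  rw [hval] at h
  exact h

end WidthTwo

end HV

end Literature.Probability.RandomPlanarGeometry.SAW
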